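import Summits.BirchSwinnertonDyer.BirchSwinnertonDyer.Theorems.ThetaPartnerAtTwoSignedMainConjectureCMTwoRankZeroFlatTwistMinusHecke
import HarnessLib

/-!
# Route `ThetaPartnerAtTwo`, crux K2r0P `SignedMainConjectureCMTwoRankZeroOfPub` (stmt-BirchSwinnertonDyer-24945),
# line `rankzero` v14, stub (μ♭)_A: the CRT recursion and the dilation sets for MINUS symbols at a composite
# square-free modulus (minus twin of `…FlatTwistCRT` §1/§4 and `…FlatTwistComposite` §1)

Cell `bsd-wall`, width seat `bsd-wall-tp2-p2-w3` (g2). THEOREMS ONLY (no `def`, no named fact, no `sorry`); helper `--supports`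
the crux; sequel of `…FlatTwistMinusHecke`. Word for word the plus-side proofs with `[·]⁻` for `[·]⁺` (and `[0]⁻ = 0`, so the
integer-valued quantity is `I⁻(y) = 2[y]⁻` with no normalisation): `ratMinusSymbol_add_val_natCast_div`, `ratMinusSymbol_add_crt`,
**`exists_int_twistedSumMinus_mul`** (`T⁻_a`, `T⁻_b` known mod `2ℤ` ⇒ `T⁻_{ab} ≡ ∑_{S_a×S_b} I⁻(tt'·)`), and
**`exists_dilationSetMinus_twistedSum`** (every square-free `m` prime to the level with integral `a_ℓ`: a non-empty `S_m` of
divisors of `m²` with `∑_{u mod m}(u/m)(2[x+u/m]⁻ − 2[u/m]⁻) ≡ ∑_{t∈S_m} 2[tx]⁻ (mod 2ℤ)`), used by the imaginary SQUARE-FREE twists.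
BSD is not proved by any of this.

References: B. Mazur, J. Tate, J. Teitelbaum, Invent. Math. 84 (1986) §I.4 (4.2), §I.8 [MazurTateTeitelbaum1986Invent];
K. Ireland, M. Rosen, GTM 84 (1990) Prop. 5.2.2 [IrelandRosen1990]; M. Emerton, R. Pollack, T. Weston, Invent. Math. 163 (2006)
Lemma 4.4.4 [EmertonPollackWeston2006].
-/

set_option autoImplicit false
-- the Theorems namespace of this sub repeats the summit name by design (D-0017 nested layout)
set_option linter.dupNamespace false

noncomputable section

open scoped Classical MatrixGroups ModularForm NumberField NumberTheorySymbols

open NumberField IsDedekindDomain Rat.HeightOneSpectrum CongruenceSubgroup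
  Literature.NumberTheory.EllipticCurves Literature.NumberTheory.EllipticCurves.ModularForms

namespace Summit.BirchSwinnertonDyer.BirchSwinnertonDyer.Theorems.FlatTwist

/-! ## §1. Chinese remainder on minus symbols -/

section CRT

variable {a b : ℕ} [NeZero a] [NeZero b] {N : ℕ} [NeZero N] (g : CuspForm (Gamma0 N) 2)

omit [NeZero a] [NeZero b] in
/-- `[x + (n mod m)/m]⁻ = [x + n/m]⁻` (the symbol is `1`-periodic). [cite: MazurTateTeitelbaum1986Invent, §I.4] -/
theorem ratMinusSymbol_add_val_natCast_div (x : ℚ) {m : ℕ} [NeZero m] (n : ℕ) :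
    ratMinusSymbol g (x + (((n : ZMod m)).val : ℚ) / m) = ratMinusSymbol g (x + (n : ℚ) / m) := by
  have hm : (m : ℚ) ≠ 0 := by exact_mod_cast (NeZero.ne m)
  rw [ZMod.val_natCast]
  have hdiv : (n : ℚ) / m = ((n % m : ℕ) : ℚ) / m + ((n / m : ℕ) : ℚ) := by
    have h' : (n : ℚ) = ((n % m : ℕ) : ℚ) + (m : ℚ) * ((n / m : ℕ) : ℚ) := by
      exact_mod_cast (Nat.mod_add_div n m).symm
    rw [h']
    field_simp
  have hper := ratMinusSymbol_add_intCast g (x + ((n % m : ℕ) : ℚ) / m) ((n / m : ℕ) : ℤ)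
  rw [Int.cast_natCast] at hper
  rw [hdiv, ← add_assoc, hper]

/-- **The cusp `(wb + va)/(ab)` is `w/a + v/b`** on minus symbols: `[x + u/(ab)]⁻ = [x + w/a + v/b]⁻` for `u ≡ wb + va (mod ab)`.
[cite: MazurTateTeitelbaum1986Invent, §I.4] -/
theorem ratMinusSymbol_add_crt (x : ℚ) (w : ZMod a) (v : ZMod b) :
    ratMinusSymbol g (x + (((((w.val * b + v.val * a : ℕ)) : ZMod (a * b))).val : ℚ) / ((a * b : ℕ) : ℚ)) =
      ratMinusSymbol g (x + (w.val : ℚ) / a + (v.val : ℚ) / b) := by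
  haveI : NeZero (a * b) := ⟨mul_ne_zero (NeZero.ne a) (NeZero.ne b)⟩
  have ha : (a : ℚ) ≠ 0 := by exact_mod_cast (NeZero.ne a)
  have hb : (b : ℚ) ≠ 0 := by exact_mod_cast (NeZero.ne b)
  rw [ratMinusSymbol_add_val_natCast_div]
  congr 1
  push_cast
  field_simp
  ring


end CRT

/-! ## §2. The recursion step for minus symbols -/

section Recursion

variable {N : ℕ} [NeZero N] (g : CuspForm (Gamma0 N) 2)

/-- **THE RECURSION.** Let `g` be a normalised newform of level `N` with rational coefficients, `a, b ≥ 1` coprime to each other and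
to `N`, and suppose the Jacobi-twisted sums at the moduli `a` and `b` are known modulo `2ℤ` on the cusps with denominator prime to
`N`: `T_a(y) = ∑_{t∈S_a} I⁻(ty) + 2ℤ` (`S_a` a finite set of divisors of `a²`) and `T_b(y) = ∑_{t'∈S_b} I⁻(t'y) + 2ℤ`. Then
`T_{ab}(x) = ∑_{(t,t')∈S_a×S_b} I⁻(tt'x) + 2ℤ` for every `x` with `den x` prime to `N`. Proof: Chinese remainder
`u ≡ wb + va`, `(u/ab) = ±(w/a)(v/b)`, `[x + u/ab] = [x + w/a + v/b]`; the inner `w`-sum is `T_a(x + v/b) − T_a(v/b)`; each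
resulting `v`-sum `∑_v (v/b)(I⁻(tx + tv/b) − I⁻(tv/b))` is `(t/b)·T_b(tx)` after `v ↦ tv`; all signs are `±1 ≡ 1 (mod 2)`.
[cite: MazurTateTeitelbaum1986Invent, §I.4 (4.2) and §I.8] [cite: IrelandRosen1990, Prop. 5.2.2] -/
theorem exists_int_twistedSumMinus_mul (hQ : coeffField g = ⊥) {a b : ℕ} [NeZero a] [NeZero b]
    (hab : a.Coprime b) (hbN : b.Coprime N)
    (Sa Sb : Finset ℕ) (hSa : ∀ t ∈ Sa, t ∣ a ^ 2)
    (hQa : ∀ y : ℚ, y.den.Coprime N → ∃ z : ℤ,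
      ∑ u : ZMod a, (J((u.val : ℤ) | a) : ℚ) *
          (2 * ratMinusSymbol g (y + (u.val : ℚ) / a) - 2 * ratMinusSymbol g ((u.val : ℚ) / a)) =
        ∑ t ∈ Sa, 2 * (ratMinusSymbol g ((t : ℚ) * y)) + 2 * z)
    (hQb : ∀ y : ℚ, y.den.Coprime N → ∃ z : ℤ,
      ∑ u : ZMod b, (J((u.val : ℤ) | b) : ℚ) *
          (2 * ratMinusSymbol g (y + (u.val : ℚ) / b) - 2 * ratMinusSymbol g ((u.val : ℚ) / b)) =
        ∑ t ∈ Sb, 2 * (ratMinusSymbol g ((t : ℚ) * y)) + 2 * z)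
    {x : ℚ} (hx : x.den.Coprime N) :
    ∃ z : ℤ, ∑ u : ZMod (a * b), (J((u.val : ℤ) | a * b) : ℚ) *
        (2 * ratMinusSymbol g (x + (u.val : ℚ) / ((a * b : ℕ) : ℚ)) - 2 * ratMinusSymbol g ((u.val : ℚ) / ((a * b : ℕ) : ℚ))) =
      ∑ p ∈ Sa ×ˢ Sb, 2 * (ratMinusSymbol g (((p.1 * p.2 : ℕ) : ℚ) * x)) + 2 * z := by
  haveI : NeZero (a * b) := ⟨mul_ne_zero (NeZero.ne a) (NeZero.ne b)⟩
  have hreal : ∀ n, (cuspCoeff g n).im = 0 := cuspCoeff_im_eq_zero_of_coeffField_eq_bot hQ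
  have ha0 : (a : ℚ) ≠ 0 := by exact_mod_cast (NeZero.ne a)
  have hb0 : (b : ℚ) ≠ 0 := by exact_mod_cast (NeZero.ne b)
  set σ : ℤ := J((b : ℤ) | a) * J((a : ℤ) | b) with hσ_def
  -- Step 1–2: Chinese remainder, term by term
  have hterm : ∀ (w : ZMod a) (v : ZMod b),
      (J((((((w.val * b + v.val * a : ℕ)) : ZMod (a * b))).val : ℤ) | a * b) : ℚ) *
        (2 * ratMinusSymbol g (x + (((((w.val * b + v.val * a : ℕ)) : ZMod (a * b))).val : ℚ) / ((a * b : ℕ) : ℚ)) -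
          2 * ratMinusSymbol g ((((((w.val * b + v.val * a : ℕ)) : ZMod (a * b))).val : ℚ) / ((a * b : ℕ) : ℚ))) =
      (σ : ℚ) * ((J((v.val : ℤ) | b) : ℚ) * ((J((w.val : ℤ) | a) : ℚ) *
        (2 * ratMinusSymbol g ((x + (v.val : ℚ) / b) + (w.val : ℚ) / a) -
          2 * ratMinusSymbol g ((v.val : ℚ) / b + (w.val : ℚ) / a)))) := by
    intro w v
    rw [jacobiSym_val_natCast, jacobiSym_crt, ratMinusSymbol_add_crt g x w v,
      ← zero_add ((((((w.val * b + v.val * a : ℕ)) : ZMod (a * b))).val : ℚ) / ((a * b : ℕ) : ℚ)),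
      ratMinusSymbol_add_crt g 0 w v, zero_add, hσ_def]
    have e1 : x + (w.val : ℚ) / a + (v.val : ℚ) / b = (x + (v.val : ℚ) / b) + (w.val : ℚ) / a := by ring
    have e2 : (w.val : ℚ) / a + (v.val : ℚ) / b = (v.val : ℚ) / b + (w.val : ℚ) / a := by ring
    rw [e1, e2]
    push_cast
    ring
  -- Step 3–4: the inner `w`-sum is `T_a(x + v/b) − T_a(v/b)`; apply `hQa` twice
  choose z₁ hz₁ using fun v : ZMod b ↦ hQa (x + (v.val : ℚ) / b) (coprime_den_add_natCast_div hx hbN v.val)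
  choose z₀ hz₀ using fun v : ZMod b ↦ hQa ((v.val : ℚ) / b) (coprime_den_natCast_div hbN v.val)
  have hinner : ∀ v : ZMod b, ∑ w : ZMod a, (J((w.val : ℤ) | a) : ℚ) *
      (2 * ratMinusSymbol g ((x + (v.val : ℚ) / b) + (w.val : ℚ) / a) -
        2 * ratMinusSymbol g ((v.val : ℚ) / b + (w.val : ℚ) / a)) =
      ∑ t ∈ Sa, (2 * ratMinusSymbol g ((t : ℚ) * x + ((t * v.val : ℕ) : ℚ) / b) -
        2 * ratMinusSymbol g (((t * v.val : ℕ) : ℚ) / b)) + 2 * ((z₁ v : ℚ) - z₀ v) := by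
    intro v
    have hsplit : ∑ w : ZMod a, (J((w.val : ℤ) | a) : ℚ) *
        (2 * ratMinusSymbol g ((x + (v.val : ℚ) / b) + (w.val : ℚ) / a) -
          2 * ratMinusSymbol g ((v.val : ℚ) / b + (w.val : ℚ) / a)) =
        ∑ w : ZMod a, (J((w.val : ℤ) | a) : ℚ) *
            (2 * ratMinusSymbol g ((x + (v.val : ℚ) / b) + (w.val : ℚ) / a) - 2 * ratMinusSymbol g ((w.val : ℚ) / a)) -
          ∑ w : ZMod a, (J((w.val : ℤ) | a) : ℚ) *
            (2 * ratMinusSymbol g ((v.val : ℚ) / b + (w.val : ℚ) / a) - 2 * ratMinusSymbol g ((w.val : ℚ) / a)) := by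
      rw [← Finset.sum_sub_distrib]
      exact Finset.sum_congr rfl fun w _ ↦ by ring
    rw [hsplit, hz₁ v, hz₀ v]
    have hts : ∑ t ∈ Sa, 2 * (ratMinusSymbol g ((t : ℚ) * (x + (v.val : ℚ) / b))) -
        ∑ t ∈ Sa, 2 * (ratMinusSymbol g ((t : ℚ) * ((v.val : ℚ) / b))) =
        ∑ t ∈ Sa, (2 * ratMinusSymbol g ((t : ℚ) * x + ((t * v.val : ℕ) : ℚ) / b) -
          2 * ratMinusSymbol g (((t * v.val : ℕ) : ℚ) / b)) := by
      rw [← Finset.sum_sub_distrib]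
      refine Finset.sum_congr rfl fun t _ ↦ ?_
      have e1 : (t : ℚ) * (x + (v.val : ℚ) / b) = (t : ℚ) * x + ((t * v.val : ℕ) : ℚ) / b := by push_cast; ring
      have e2 : (t : ℚ) * ((v.val : ℚ) / b) = ((t * v.val : ℕ) : ℚ) / b := by push_cast; ring
      rw [e1, e2]
    linear_combination hts
  -- Step 5–6: for each `t ∈ Sa`, `∑_v (v/b)·(2[tx + tv/b] − 2[tv/b]) = (t/b)·T_b(tx)`; apply `hQb`
  choose z₂ hz₂ using fun t : ℕ ↦ hQb ((t : ℚ) * x) (coprime_den_natCast_mul hx t)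
  have hdil : ∀ t ∈ Sa, ∑ v : ZMod b, (J((v.val : ℤ) | b) : ℚ) *
      (2 * ratMinusSymbol g ((t : ℚ) * x + ((t * v.val : ℕ) : ℚ) / b) - 2 * ratMinusSymbol g (((t * v.val : ℕ) : ℚ) / b)) =
      (J((t : ℤ) | b) : ℚ) * (∑ t' ∈ Sb, 2 * (ratMinusSymbol g ((t' : ℚ) * ((t : ℚ) * x))) + 2 * z₂ t) := by
    intro t ht
    have htb : t.Coprime b := Nat.Coprime.coprime_dvd_left (hSa t ht) (Nat.Coprime.pow_left 2 hab)
    -- periodicity: `t·v.val` may be replaced by `(t·v).val`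
    have hper : ∀ v : ZMod b, 2 * ratMinusSymbol g ((t : ℚ) * x + ((t * v.val : ℕ) : ℚ) / b) -
        2 * ratMinusSymbol g (((t * v.val : ℕ) : ℚ) / b) =
        2 * ratMinusSymbol g ((t : ℚ) * x + ((((t : ZMod b) * v).val : ℕ) : ℚ) / b) -
          2 * ratMinusSymbol g (((((t : ZMod b) * v).val : ℕ) : ℚ) / b) := by
      intro v
      have hc : ((t * v.val : ℕ) : ZMod b) = (t : ZMod b) * v := by push_cast; rw [ZMod.natCast_zmod_val]
      rw [← ratMinusSymbol_add_val_natCast_div g ((t : ℚ) * x) (t * v.val), hc,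
        ← zero_add ((((t * v.val : ℕ) : ℚ)) / (b : ℚ)), ← ratMinusSymbol_add_val_natCast_div g 0 (t * v.val), hc, zero_add]
    rw [Finset.sum_congr rfl fun v _ ↦ by rw [hper v]]
    rw [sum_jacobi_mul_dilate htb (fun n ↦ 2 * ratMinusSymbol g ((t : ℚ) * x + (n : ℚ) / b) - 2 * ratMinusSymbol g ((n : ℚ) / b)),
      hz₂ t]
  -- integers `I⁻(tt'x)` and odd signs
  choose i hi using fun q : ℕ × ℕ ↦
    exists_two_mul_ratMinusSymbol_eq_intCast g hreal (coprime_den_natCast_mul hx (q.1 * q.2))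
  have hσ : σ = 1 ∨ σ = -1 := by
    have h1 := jacobiSym.eq_one_or_neg_one (a := (b : ℤ)) (b := a) (by rw [Int.gcd_natCast_natCast]; exact hab.symm)
    have h2 := jacobiSym.eq_one_or_neg_one (a := (a : ℤ)) (b := b) (by rw [Int.gcd_natCast_natCast]; exact hab)
    rcases h1 with h1 | h1 <;> rcases h2 with h2 | h2 <;> simp [hσ_def, h1, h2]
  have hcodd : ∀ q ∈ Sa ×ˢ Sb, Odd (σ * J((q.1 : ℤ) | b)) := by
    intro q hq
    have ht : q.1 ∈ Sa := (Finset.mem_product.mp hq).1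
    have htb : q.1.Coprime b := Nat.Coprime.coprime_dvd_left (hSa q.1 ht) (Nat.Coprime.pow_left 2 hab)
    exact (odd_of_eq_one_or_eq_neg_one hσ).mul
      (odd_of_eq_one_or_eq_neg_one (jacobiSym.eq_one_or_neg_one (by rw [Int.gcd_natCast_natCast]; exact htb)))
  -- Step 7: assemble into `∑_q c_q · i_q + 2r` with odd `c_q`
  set R₁ : ℤ := ∑ v : ZMod b, J((v.val : ℤ) | b) * (z₁ v - z₀ v) with hR₁
  set R₂ : ℤ := ∑ t ∈ Sa, J((t : ℤ) | b) * z₂ t with hR₂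
  have hE : ∀ t t' : ℕ, 2 * (ratMinusSymbol g ((t' : ℚ) * ((t : ℚ) * x))) = (i (t, t') : ℚ) := by
    intro t t'
    rw [← hi (t, t')]
    push_cast
    ring_nf
  have hmain : ∑ u : ZMod (a * b), (J((u.val : ℤ) | a * b) : ℚ) *
      (2 * ratMinusSymbol g (x + (u.val : ℚ) / ((a * b : ℕ) : ℚ)) - 2 * ratMinusSymbol g ((u.val : ℚ) / ((a * b : ℕ) : ℚ))) =
      ((∑ q ∈ Sa ×ˢ Sb, (σ * J((q.1 : ℤ) | b)) * i q : ℤ) : ℚ) + 2 * ((σ * (R₂ + R₁) : ℤ) : ℚ) := by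
    calc _ = ∑ w : ZMod a, ∑ v : ZMod b, (σ : ℚ) * ((J((v.val : ℤ) | b) : ℚ) * ((J((w.val : ℤ) | a) : ℚ) *
            (2 * ratMinusSymbol g ((x + (v.val : ℚ) / b) + (w.val : ℚ) / a) -
              2 * ratMinusSymbol g ((v.val : ℚ) / b + (w.val : ℚ) / a)))) := by
          rw [sum_zmod_mul_eq_sum_sum hab]
          exact Finset.sum_congr rfl fun w _ ↦ Finset.sum_congr rfl fun v _ ↦ hterm w v
      _ = ∑ v : ZMod b, ∑ w : ZMod a, (σ : ℚ) * ((J((v.val : ℤ) | b) : ℚ) * ((J((w.val : ℤ) | a) : ℚ) *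
            (2 * ratMinusSymbol g ((x + (v.val : ℚ) / b) + (w.val : ℚ) / a) -
              2 * ratMinusSymbol g ((v.val : ℚ) / b + (w.val : ℚ) / a)))) := Finset.sum_comm
      _ = ∑ v : ZMod b, (σ : ℚ) * ((J((v.val : ℤ) | b) : ℚ) *
            (∑ t ∈ Sa, (2 * ratMinusSymbol g ((t : ℚ) * x + ((t * v.val : ℕ) : ℚ) / b) -
              2 * ratMinusSymbol g (((t * v.val : ℕ) : ℚ) / b)) + 2 * ((z₁ v : ℚ) - z₀ v))) := by
          refine Finset.sum_congr rfl fun v _ ↦ ?_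
          rw [← hinner v, Finset.mul_sum, Finset.mul_sum]
      _ = (σ : ℚ) * (∑ t ∈ Sa, ∑ v : ZMod b, (J((v.val : ℤ) | b) : ℚ) *
              (2 * ratMinusSymbol g ((t : ℚ) * x + ((t * v.val : ℕ) : ℚ) / b) -
                2 * ratMinusSymbol g (((t * v.val : ℕ) : ℚ) / b))) +
            2 * ((σ : ℚ) * ∑ v : ZMod b, (J((v.val : ℤ) | b) : ℚ) * ((z₁ v : ℚ) - z₀ v)) := by
          have h1 : ∀ v : ZMod b, (σ : ℚ) * ((J((v.val : ℤ) | b) : ℚ) *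
              (∑ t ∈ Sa, (2 * ratMinusSymbol g ((t : ℚ) * x + ((t * v.val : ℕ) : ℚ) / b) -
                2 * ratMinusSymbol g (((t * v.val : ℕ) : ℚ) / b)) + 2 * ((z₁ v : ℚ) - z₀ v))) =
              (σ : ℚ) * ((J((v.val : ℤ) | b) : ℚ) *
                ∑ t ∈ Sa, (2 * ratMinusSymbol g ((t : ℚ) * x + ((t * v.val : ℕ) : ℚ) / b) -
                  2 * ratMinusSymbol g (((t * v.val : ℕ) : ℚ) / b))) +
              2 * ((σ : ℚ) * ((J((v.val : ℤ) | b) : ℚ) * ((z₁ v : ℚ) - z₀ v))) := fun v ↦ by ring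
          rw [Finset.sum_congr rfl fun v _ ↦ h1 v, Finset.sum_add_distrib, ← Finset.mul_sum, ← Finset.mul_sum,
            ← Finset.mul_sum]
          congr 1
          congr 1
          simp_rw [Finset.mul_sum]
          exact Finset.sum_comm
      _ = (σ : ℚ) * (∑ t ∈ Sa, (J((t : ℤ) | b) : ℚ) *
              (∑ t' ∈ Sb, 2 * (ratMinusSymbol g ((t' : ℚ) * ((t : ℚ) * x))) + 2 * z₂ t)) +
            2 * ((σ : ℚ) * ∑ v : ZMod b, (J((v.val : ℤ) | b) : ℚ) * ((z₁ v : ℚ) - z₀ v)) := by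
          rw [Finset.sum_congr rfl fun t ht ↦ hdil t ht]
      _ = _ := by
          rw [Finset.sum_product, hR₁, hR₂]
          push_cast
          simp only [hE, mul_add, Finset.mul_sum, Finset.sum_add_distrib]
          ring_nf
  rw [hmain]
  obtain ⟨z, hz⟩ := exists_int_sum_oddMul_eq (Sa ×ˢ Sb) (fun q ↦ σ * J((q.1 : ℤ) | b)) i hcodd (σ * (R₂ + R₁))
  refine ⟨z, ?_⟩
  rw [hz]
  congr 1
  push_cast
  refine Finset.sum_congr rfl fun q _ ↦ ?_
  have h := hi q
  push_cast at h
  exact h.symm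


end Recursion

/-! ## §3. Dilation sets for square-free moduli (minus symbols) -/

section Dilation

variable {N : ℕ} [NeZero N] (g : CuspForm (Gamma0 N) 2)

/-- **THE DILATION SET OF A SQUARE-FREE MODULUS.** For a normalised newform `g` of level `N` with rational coefficients, every
SQUARE-FREE `m` prime to `N` whose prime divisors `ℓ` have integral Hecke eigenvalue `a_ℓ(g)` admits a non-empty finite set `S_m`
of divisors of `m²` with `∑_{u mod m} (u/m)(2[x + u/m]⁻_g − 2[u/m]⁻_g) = ∑_{t∈S_m} 2[tx]⁻_g + 2ℤ` for every `x` with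
`den x` prime to `N` — induction on the primes of `m` (`induction_on_primes`): `S_1 = {1}`, `S_ℓ` from `exists_dilationSetMinus_prime`,
`S_{ℓm} = S_ℓ·S_m` from the recursion `exists_int_twistedSumMinus_mul`. [cite: MazurTateTeitelbaum1986Invent, §I.4 (4.2) and §I.8]
[cite: EmertonPollackWeston2006, Lemma 4.4.4] -/
theorem exists_dilationSetMinus_twistedSum (hg : IsNewform0 g) (hQ : coeffField g = ⊥) :
    ∀ (m : ℕ) [NeZero m], Squarefree m → m.Coprime N →
      (∀ ℓ : ℕ, ℓ.Prime → ℓ ∣ m → ∃ a : ℤ, cuspCoeff g ℓ = a) →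
      ∃ S : Finset ℕ, S.Nonempty ∧ (∀ t ∈ S, t ∣ m ^ 2) ∧
        ∀ x : ℚ, x.den.Coprime N → ∃ z : ℤ,
          ∑ u : ZMod m, (J((u.val : ℤ) | m) : ℚ) *
              (2 * ratMinusSymbol g (x + (u.val : ℚ) / m) - 2 * ratMinusSymbol g ((u.val : ℚ) / m)) =
            ∑ t ∈ S, 2 * (ratMinusSymbol g ((t : ℚ) * x)) + 2 * z := by
  refine induction_on_primes ?_ ?_ ?_
  · intro _ hsq
    exact absurd hsq (by simp)
  · intro _ _ _ _
    refine ⟨{1}, by simp, by simp, fun x _ ↦ ⟨0, ?_⟩⟩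
    have hv : ∀ u : ZMod 1, u.val = 0 := fun u ↦ Nat.lt_one_iff.mp (ZMod.val_lt u)
    rw [Fintype.sum_unique, Finset.sum_singleton]
    simp only [hv, Nat.cast_zero, zero_div, add_zero, jacobiSym.one_right, Int.cast_one, one_mul, Nat.cast_one,
      Int.cast_zero, mul_zero, ratMinusSymbol_zero, sub_zero]
  · intro p a hp ih _ hsq hcop hint
    obtain ⟨hpa, -, hsqa⟩ := Nat.squarefree_mul_iff.mp hsq
    have hpa0 : p * a ≠ 0 := NeZero.ne (p * a)
    haveI : NeZero a := ⟨fun h ↦ hpa0 (by rw [h, mul_zero])⟩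
    haveI : NeZero p := ⟨hp.ne_zero⟩
    have hpN : p.Coprime N := Nat.Coprime.coprime_mul_right hcop
    have haN : a.Coprime N := Nat.Coprime.coprime_mul_left hcop
    have hpN' : ¬ p ∣ N := fun h ↦ hp.one_lt.ne' (Nat.Coprime.eq_one_of_dvd hpN h)
    obtain ⟨ap, hap⟩ := hint p hp (dvd_mul_right p a)
    obtain ⟨Sp, hSp, hSpd, hQp⟩ := exists_dilationSetMinus_prime g hg hQ hp hpN' hap
    obtain ⟨Sa, hSa, hSad, hQa⟩ := ih hsqa haN (fun ℓ hℓ hℓa ↦ hint ℓ hℓ (dvd_mul_of_dvd_right hℓa p))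
    refine ⟨(Sp ×ˢ Sa).image (fun q ↦ q.1 * q.2), (hSp.product hSa).image _, ?_, ?_⟩
    · intro t ht
      obtain ⟨q, hq, rfl⟩ := Finset.mem_image.mp ht
      obtain ⟨hq1, hq2⟩ := Finset.mem_product.mp hq
      rw [mul_pow]
      exact mul_dvd_mul (hSpd _ hq1) (hSad _ hq2)
    · intro x hx
      obtain ⟨z, hz⟩ := exists_int_twistedSumMinus_mul g hQ hpa haN Sp Sa hSpd hQp hQa hx
      refine ⟨z, ?_⟩
      rw [hz, Finset.sum_image (mul_injOn_divisors_sq hpa hp.ne_zero hSpd hSad)]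


end Dilation

end Summit.BirchSwinnertonDyer.BirchSwinnertonDyer.Theorems.FlatTwist

end
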